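import Summits.HodgeConjecture.CorCM.SexticCMThreefoldPairPowersHodgeOfMarkman
import Summits.HodgeConjecture.CorCM.CyclicSexticHodgeRungOfMarkman
import Summits.HodgeConjecture.CorCM.Model.CMProdBiproduct
import HarnessLib

/-!
# COR-CM — the Hodge conjecture for ALL PRODUCTS OF COPIES `E^c × B^a` of ONE simple CM abelian threefold `B` of ANY
# sextic CM field `K ⊇ k` and the CM elliptic curve `E` of `k`, modulo Markman's fourfold theorem

Cell `pub-hodgecm2` (COR-CM), seat b30 gen 15 (2026-08-21); COUNT-NEUTRAL; theorems only, no definition, no named fact,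
no `sorry`.  The uniform single-threefold statement, by cases on `K`:

* `K/ℚ` GALOIS (cyclic sextic): gen 11/12's André face reduction on the model universe of record,
  `CyclicSextic.hodgeConjectureFor_of_avDominatedBy_isProductOf_sextic_of_markman_closed`, after re-bracketing the
  biproduct `⨁_j ![E, B] (κ j)` as a binary product tree (`exists_isProductOf_iso_biproduct`, by
  `Domination.nonempty_biproduct_iso_biprod_castSucc` and `AbelianVariety.biprodIsoProd`);
* `K/ℚ` NOT Galois: an AUXILIARY second threefold — flip the two conjugate pairs of two members of `Φ` with different
  restrictions to `k` (`exists_cmType_flip`: a type `Φ₁ ≠ Φ, Φ̄` again not induced from `k`), realise it by the tree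
  theorem `cmAbelianVarietyRealised_holds` (`Domination.isCMTypeRealisation_cmCode`), and apply gen 15's pair theorem
  `DihedralSexticPairCurvePowers.hodgeConjectureFor_biproduct_comp_of_not_isGalois_of_markman` with a slot map avoiding
  the auxiliary slot.

MAIN THEOREM `SexticCMThreefold.hodgeConjectureFor_biproduct_comp_vec_of_markman`: `K` ANY CM field of degree `6`, `k`
imaginary quadratic with `i : k →+* K`, `E ⊨ (k; Ψ)` a CM elliptic curve, `B ⊨ (K; Φ)` a SIMPLE abelian threefold: for
every `κ : Fin N → Fin 2`, every rational `(p,p)`-class on `⨁_j ![E, B] (κ j)` — i.e. on `E^c × B^a`, all `a, c`, any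
order — is algebraic, GIVEN ONLY `Markman2025_weilClasses_algebraic_abelianFourfold`; likewise for every abelian variety
isogenous to such a product and for all its powers.  HONEST FRAMING: conditional on Markman only; `HC_CM` is not
asserted.  [cite: Markman2025SurveySecant, Thm. 1.2] [cite: Andre1992HodgeCM, Théorème] [cite: Shimura1998, §5.2, §8.4]
[cite: Pohlmann1968, Thm 1] [cite: MumfordAV1970, §19]

## References
* [Markman2025SurveySecant] E. Markman, arXiv:2509.23403, Thm. 1.2.  [Andre1992HodgeCM] Y. André, Progr. Math. 102
  (1992), Théorème.  [Shimura1998] G. Shimura, *Abelian Varieties with Complex Multiplication and Modular Functions*,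
  §5.2, §8.4.  [Pohlmann1968] Ann. of Math. 88, Thm 1.  [MumfordAV1970] §19.
-/

noncomputable section

open CategoryTheory CategoryTheory.Limits NumberField

namespace Summit.HodgeConjecture.CorCM.SexticCMThreefold

open Literature.AlgebraicGeometry Literature.AlgebraicGeometry.Motives Literature.AlgebraicGeometry.HodgeTheory
open Literature.AlgebraicGeometry.Motives.AbelianVariety (IsProductOf biprodIsoProd)
open Literature.AlgebraicGeometry.ComplexMultiplication (IsCMTypeRealisation)

/-! ## §1 An auxiliary CM type: flipping two conjugate pairs -/

section Flip

variable {K k : Type} [Field K] [NumberField K] [Field k]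

/-- **Flipping two conjugate pairs of a CM type.**  If `Φ` has two members `s₀, s₀'` with different restrictions along
`i : k → K` (`Φ` not induced from `k`) and `[K:ℚ] = 6`, then the CM type `Φ₁ = Φ Δ {s₀, s̄₀, s₀', s̄₀'}` satisfies
`Φ ≠ Φ₁`, `Φ₁ ≠ Φ̄ = Φᶜ` (they agree outside the four flipped embeddings, and there is a fifth), and `Φ₁` is again
not induced from `k` (`s̄₀, s̄₀' ∈ Φ₁` restrict differently). [cite: Shimura1998, §5.2 and §8.4 (types of a sextic
CM field)] -/
theorem exists_cmType_flip (h6 : Module.finrank ℚ K = 6) (i : k →+* K) (Φ : CMType K)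
    (hprim : ∃ s ∈ Φ.1, ∃ s' ∈ Φ.1, s.comp i ≠ s'.comp i) :
    ∃ Φ₁ : CMType K, Φ.1 ≠ Φ₁.1 ∧ Φ₁.1 ≠ Φ.1ᶜ ∧ ∃ s ∈ Φ₁.1, ∃ s' ∈ Φ₁.1, s.comp i ≠ s'.comp i := by
  classical
  obtain ⟨s₀, hs₀, s₀', hs₀', hne⟩ := hprim
  -- the flip set `D` and its conjugation-stability
  let D : Set (K →+* ℂ) := {s₀, ComplexEmbedding.conjugate s₀, s₀', ComplexEmbedding.conjugate s₀'}
  have hDconj : ∀ φ : K →+* ℂ, ComplexEmbedding.conjugate φ ∈ D ↔ φ ∈ D := by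
    intro φ
    simp only [D, Set.mem_insert_iff, Set.mem_singleton_iff]
    have hinv : ∀ a b : K →+* ℂ, ComplexEmbedding.conjugate a = b ↔ a = ComplexEmbedding.conjugate b := by
      intro a b
      constructor
      · rintro rfl; exact (ComplexEmbedding.involutive_conjugate K a).symm
      · rintro rfl; exact ComplexEmbedding.involutive_conjugate K b
    rw [hinv, hinv, hinv, hinv, ComplexEmbedding.involutive_conjugate K s₀, ComplexEmbedding.involutive_conjugate K s₀']
    tauto
  -- the flipped type `S = Φ Δ D`
  set S : Set (K →+* ℂ) := {s | s ∈ Φ.1 ↔ s ∉ D} with hS_def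
  have hmemS : ∀ s : K →+* ℂ, s ∈ S ↔ (s ∈ Φ.1 ↔ s ∉ D) := fun s => Iff.rfl
  have hcm : ∀ φ : K →+* ℂ, φ ∈ S ↔ ComplexEmbedding.conjugate φ ∉ S := by
    intro φ
    have h1 : ComplexEmbedding.conjugate φ ∈ Φ.1 ↔ φ ∉ Φ.1 := by
      rw [Φ.2 (ComplexEmbedding.conjugate φ), ComplexEmbedding.involutive_conjugate K φ]
    rw [hmemS, hmemS, h1, hDconj φ]
    tauto
  -- the two conjugates `s̄₀', s̄₀` are members of `S` outside `Φ`
  have hc₀' : ComplexEmbedding.conjugate s₀' ∈ S :=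
    (hmemS _).2 ⟨fun h' => absurd h' ((Φ.2 s₀').1 hs₀'), fun h' => absurd (by simp [D]) h'⟩
  have hc₀ : ComplexEmbedding.conjugate s₀ ∈ S :=
    (hmemS _).2 ⟨fun h' => absurd h' ((Φ.2 s₀).1 hs₀), fun h' => absurd (by simp [D]) h'⟩
  refine ⟨⟨S, hcm⟩, ?_, ?_, ⟨ComplexEmbedding.conjugate s₀', hc₀', ComplexEmbedding.conjugate s₀, hc₀, ?_⟩⟩
  · -- `Φ ≠ S`: `s̄₀' ∈ S ∖ Φ`
    intro h
    have hc : ComplexEmbedding.conjugate s₀' ∉ Φ.1 := (Φ.2 s₀').1 hs₀'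
    exact hc (by rw [h]; exact hc₀')
  · -- `S ≠ Φᶜ`: a fifth embedding `t ∉ D` lies in both or neither
    intro h
    obtain ⟨t, htD⟩ : ∃ t : K →+* ℂ, t ∉ D := by
      by_contra hall
      push Not at hall
      have hsub : (Finset.univ : Finset (K →+* ℂ)) ⊆
          {s₀, ComplexEmbedding.conjugate s₀, s₀', ComplexEmbedding.conjugate s₀'} := fun t _ => by
        have ht := hall t
        simp only [D, Set.mem_insert_iff, Set.mem_singleton_iff] at ht
        simp only [Finset.mem_insert, Finset.mem_singleton]
        exact ht
      have hcard := Finset.card_le_card hsub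
      rw [Finset.card_univ, NumberField.Embeddings.card K ℂ, h6] at hcard
      have h4 : ({s₀, ComplexEmbedding.conjugate s₀, s₀', ComplexEmbedding.conjugate s₀'} :
          Finset (K →+* ℂ)).card ≤ 4 := Finset.card_le_four
      omega
    have ht : t ∈ S ↔ t ∈ Φ.1 := by
      rw [hmemS]
      exact ⟨fun h' => h'.2 htD, fun h' => ⟨fun _ => htD, fun _ => h'⟩⟩
    have ht' : t ∈ S ↔ t ∉ Φ.1 := by
      change t ∈ (⟨S, hcm⟩ : CMType K).1 ↔ _
      rw [h, Set.mem_compl_iff]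
    exact iff_not_self (ht.symm.trans ht')
  · -- not induced: `s̄₀', s̄₀` restrict to `τ̄₀' ≠ τ̄₀`
    intro h
    apply hne
    have h' : ComplexEmbedding.conjugate (s₀'.comp i) = ComplexEmbedding.conjugate (s₀.comp i) := by
      have e1 : (ComplexEmbedding.conjugate s₀').comp i = ComplexEmbedding.conjugate (s₀'.comp i) :=
        RingHom.ext fun _ => rfl
      have e2 : (ComplexEmbedding.conjugate s₀).comp i = ComplexEmbedding.conjugate (s₀.comp i) :=
        RingHom.ext fun _ => rfl
      rw [← e1, ← e2, h]
    exact ((ComplexEmbedding.involutive_conjugate k).injective h').symm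

end Flip

/-! ## §2 Biproducts over `Fin (n+1)` are binary product trees -/

/-- **Re-bracketing**: a biproduct `⨁_{j : Fin (n+1)} f j` of abelian varieties all satisfying `Q` is isomorphic to a
binary product tree of members of `Q` (`AbelianVariety.IsProductOf Q`) — split off the last summand
(`Domination.nonempty_biproduct_iso_biprod_castSucc`), `biprod ≅ prod` (`AbelianVariety.biprodIsoProd`), induct.
[cite: MumfordAV1970, §19 (Hom(C, A × B) = Hom(C, A) ⊕ Hom(C, B))] -/
theorem exists_isProductOf_iso_biproduct {Q : AbelianVariety ℂ → Prop} :
    ∀ (n : ℕ) (f : Fin (n + 1) → AbelianVariety ℂ), (∀ j, Q (f j)) →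
      ∃ P : AbelianVariety ℂ, IsProductOf Q P ∧ Nonempty ((⨁ f) ≅ P)
  | 0, f, hf => by
      haveI : Unique (Fin (0 + 1)) := inferInstanceAs (Unique (Fin 1))
      exact ⟨f 0, IsProductOf.atom (hf 0),
        ⟨biproductUniqueIso f ≪≫ eqToIso (congrArg f (Subsingleton.elim _ _))⟩⟩
  | n + 1, f, hf => by
      obtain ⟨P', hP', ⟨e'⟩⟩ := exists_isProductOf_iso_biproduct n (fun i => f i.castSucc) fun i => hf _
      obtain ⟨e₁⟩ := Domination.nonempty_biproduct_iso_biprod_castSucc (n + 1) f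
      exact ⟨P'.prod (f (Fin.last (n + 1))), hP'.prod (IsProductOf.atom (hf _)),
        ⟨e₁ ≪≫ biprod.mapIso e' (Iso.refl _) ≪≫ biprodIsoProd _ _⟩⟩

/-! ## §3 Galois sextic `K`: gen 11/12's André face reduction, re-bracketed -/

section Galois

variable {k K : Type} [Field k] [NumberField k] [IsCMField k] [Field K] [NumberField K] [IsCMField K] {N : ℕ}
  {E : AbelianVariety ℂ} {Ψ : CMType k} {ιE : 𝓞 k →+* End E} {θE : k →+* Module.End ℂ (complexBetti E.X 1)}
  {B : AbelianVariety ℂ} {Φ : CMType K} {ιB : 𝓞 K →+* End B} {θB : K →+* Module.End ℂ (complexBetti B.X 1)}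

/-- **`K` Galois sextic: the Hodge conjecture for every `⨁_j ![E, B] (κ j)` modulo Markman** (`B ⊨ (K; Φ)` ANY
realisation, `E ⊨ (k; Ψ)`, `i : k → K`): the biproduct is a product tree of realisations of types of CM subfields of
`K`, to which `CyclicSextic.hodgeConjectureFor_of_avDominatedBy_isProductOf_sextic_of_markman_closed` applies.
[cite: Markman2025SurveySecant, Thm. 1.2] [cite: Andre1992HodgeCM, Théorème (pp. 4–5)] -/
theorem hodgeConjectureFor_biproduct_comp_vec_of_isGalois_of_markman [IsGalois ℚ K]
    (hW4 : Markman2025_weilClasses_algebraic_abelianFourfold) (h6 : Module.finrank ℚ K = 6) (i : k →+* K)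
    (hE : IsCMTypeRealisation Ψ E ιE θE) (hB : IsCMTypeRealisation Φ B ιB θB) (κ : Fin N → Fin 2) :
    HodgeConjectureFor (⨁ fun j => (![E, B] : Fin 2 → AbelianVariety ℂ) (κ j)).dim
      (⨁ fun j => (![E, B] : Fin 2 → AbelianVariety ℂ) (κ j)).X := by
  -- the atoms: realisations of types of CM fields embedded in `K`
  let Q : AbelianVariety ℂ → Prop := fun B' =>
    ∃ (E' : Type) (_ : Field E') (_ : NumberField E') (_ : IsCMField E') (_ : E' →+* ((CMField.mk K : CMField) : Type))
      (Φ' : CMType E') (ι' : 𝓞 E' →+* CategoryTheory.End B') (θ' : E' →+* Module.End ℂ (complexBetti B'.X 1)),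
      IsCMTypeRealisation Φ' B' ι' θ'
  have hQE : Q E := ⟨k, inferInstance, inferInstance, inferInstance, i, Ψ, ιE, θE, hE⟩
  have hQB : Q B := ⟨K, inferInstance, inferInstance, inferInstance, RingHom.id K, Φ, ιB, θB, hB⟩
  have hQ : ∀ x : Fin 2, Q ((![E, B] : Fin 2 → AbelianVariety ℂ) x) := Fin.forall_fin_two.2 ⟨hQE, hQB⟩
  have hEhc : HodgeConjectureFor E.dim E.X :=
    CyclicSextic.hodgeConjectureFor_of_avDominatedBy_isProductOf_sextic_of_markman_closed hW4 (CMField.mk K) h6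
      (IsProductOf.atom hQE) (Domination.AVDominatedBy.refl E)
  rcases N with _ | n
  · -- the empty product has dimension `0`
    exact Domination.hodgeConjectureFor_of_avDominatedBy hEhc
      (AndreRiemann.avDominatedBy_of_dim_eq_zero (dim_biproduct_of_isEmpty _) E)
  · obtain ⟨P, hP, ⟨e⟩⟩ := exists_isProductOf_iso_biproduct (Q := Q) n
      (fun j => (![E, B] : Fin 2 → AbelianVariety ℂ) (κ j)) fun j => hQ (κ j)
    exact CyclicSextic.hodgeConjectureFor_of_avDominatedBy_isProductOf_sextic_of_markman_closed hW4 (CMField.mk K) h6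
      hP (Domination.AVDominatedBy.of_iso e (Domination.AVDominatedBy.refl P))

end Galois

/-! ## §4 Non-Galois sextic `K`: an auxiliary conjugate threefold -/

section NonGalois

variable {k K : Type} [Field k] [NumberField k] [IsCMField k] [Field K] [NumberField K] [IsCMField K] {N : ℕ}
  {E : AbelianVariety ℂ} {Ψ : CMType k} {ιE : 𝓞 k →+* End E} {θE : k →+* Module.End ℂ (complexBetti E.X 1)}
  {B₀ B₁ : AbelianVariety ℂ} {Φ₀ Φ₁ : CMType K} {ι₀ : 𝓞 K →+* End B₀} {ι₁ : 𝓞 K →+* End B₁}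
  {θ₀ : K →+* Module.End ℂ (complexBetti B₀.X 1)} {θ₁ : K →+* Module.End ℂ (complexBetti B₁.X 1)}

/-- **The pair theorem, intrinsic `vec` form**: `K ⊇ i(k)` sextic CM NOT Galois, `E ⊨ (k; Ψ)`, `B₀ ⊨ (K; Φ₀)`,
`B₁ ⊨ (K; Φ₁)` with `Φ_m` not induced from `k` and `Φ₁ ≠ Φ₀, Φ̄₀` — HC for every `⨁_j ![E, B₀, B₁] (κ j)` modulo
Markman (gen 15's `DihedralSexticPairCurvePowers.hodgeConjectureFor_biproduct_comp_of_not_isGalois_of_markman` at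
`Kf = (k, K)`). [cite: Markman2025SurveySecant, Thm. 1.2] [cite: Pohlmann1968, Thm 1] [cite: Shimura1998, §8.4] -/
theorem hodgeConjectureFor_biproduct_comp_vec₃_of_not_isGalois_of_markman
    (hW4 : Markman2025_weilClasses_algebraic_abelianFourfold)
    (h6 : Module.finrank ℚ K = 6) (h2 : Module.finrank ℚ k = 2) (i : k →+* K) (hK : ¬ IsGalois ℚ K)
    (hE : IsCMTypeRealisation Ψ E ιE θE) (hB₀ : IsCMTypeRealisation Φ₀ B₀ ι₀ θ₀)
    (hB₁ : IsCMTypeRealisation Φ₁ B₁ ι₁ θ₁)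
    (hprim₀ : ∃ s ∈ Φ₀.1, ∃ s' ∈ Φ₀.1, s.comp i ≠ s'.comp i)
    (hprim₁ : ∃ s ∈ Φ₁.1, ∃ s' ∈ Φ₁.1, s.comp i ≠ s'.comp i)
    (hne : Φ₀.1 ≠ Φ₁.1) (hne' : Φ₁.1 ≠ Φ₀.1ᶜ) (κ : Fin N → Fin 3) :
    HodgeConjectureFor (⨁ fun j => (![E, B₀, B₁] : Fin 3 → AbelianVariety ℂ) (κ j)).dim
      (⨁ fun j => (![E, B₀, B₁] : Fin 3 → AbelianVariety ℂ) (κ j)).X := by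
  let Kf : Fin 2 → Type := Fin.cons k fun _ : Fin 1 => K
  letI instF : ∀ j, Field (Kf j) := fun j =>
    Fin.cases (motive := fun j => Field (Kf j)) ‹Field k› (fun _ => ‹Field K›) j
  letI instN : ∀ j, NumberField (Kf j) := fun j =>
    Fin.cases (motive := fun j => NumberField (Kf j)) ‹NumberField k› (fun _ => ‹NumberField K›) j
  haveI instC : ∀ j, IsCMField (Kf j) := fun j =>
    Fin.cases (motive := fun j => IsCMField (Kf j)) ‹IsCMField k› (fun _ => ‹IsCMField K›) j
  let A : Fin 2 → AbelianVariety ℂ := ![B₀, B₁]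
  let Φ : Fin 2 → CMType K := ![Φ₀, Φ₁]
  let ι : ∀ j, 𝓞 K →+* End (A j) := Fin.cons ι₀ (Fin.cons ι₁ finZeroElim)
  let θ : ∀ j, K →+* Module.End ℂ (complexBetti (A j).X 1) := Fin.cons θ₀ (Fin.cons θ₁ finZeroElim)
  have hA : ∀ j, IsCMTypeRealisation (Φ j) (A j) (ι j) (θ j) := Fin.forall_fin_two.2 ⟨hB₀, hB₁⟩
  have hprim : ∀ j, ∃ s ∈ (Φ j).1, ∃ s' ∈ (Φ j).1, s.comp i ≠ s'.comp i := Fin.forall_fin_two.2 ⟨hprim₀, hprim₁⟩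
  exact DihedralSexticPairCurvePowers.hodgeConjectureFor_biproduct_comp_of_not_isGalois_of_markman
    (Kf := Kf) (i₀ := 0) (i₁ := 1) (A₃ := Fin.cons E A) (Φ₃ := Fin.cons Ψ Φ) (ι₃ := Fin.cons ιE ι)
    (θ₃ := Fin.cons θE θ) κ hW4 h6 h2 i hK (Fin.cases hE hA) hprim hne hne'

variable {B : AbelianVariety ℂ} {Φ : CMType K} {ιB : 𝓞 K →+* End B} {θB : K →+* Module.End ℂ (complexBetti B.X 1)}

/-- **`K` non-Galois sextic: the Hodge conjecture for every `⨁_j ![E, B] (κ j)` modulo Markman**, `B ⊨ (K; Φ)` with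
`Φ` not induced from `k`: realise the flipped type `Φ₁` of `exists_cmType_flip` (`cmAbelianVarietyRealised_holds`,
`Domination.isCMTypeRealisation_cmCode`) as an auxiliary threefold `B₁`, apply the pair theorem with the slot map
`Fin.castSucc ∘ κ` (which avoids `B₁`), and identify `⨁_j ![E, B, B₁] (castSucc (κ j)) ≅ ⨁_j ![E, B] (κ j)`.
[cite: Markman2025SurveySecant, Thm. 1.2] [cite: Shimura1998, §5.2, §8.4] [cite: MumfordAV1970, §19] -/
theorem hodgeConjectureFor_biproduct_comp_vec_of_not_isGalois_of_markman
    (hW4 : Markman2025_weilClasses_algebraic_abelianFourfold)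
    (h6 : Module.finrank ℚ K = 6) (h2 : Module.finrank ℚ k = 2) (i : k →+* K) (hK : ¬ IsGalois ℚ K)
    (hE : IsCMTypeRealisation Ψ E ιE θE) (hB : IsCMTypeRealisation Φ B ιB θB)
    (hprim : ∃ s ∈ Φ.1, ∃ s' ∈ Φ.1, s.comp i ≠ s'.comp i) (κ : Fin N → Fin 2) :
    HodgeConjectureFor (⨁ fun j => (![E, B] : Fin 2 → AbelianVariety ℂ) (κ j)).dim
      (⨁ fun j => (![E, B] : Fin 2 → AbelianVariety ℂ) (κ j)).X := by
  obtain ⟨Φ₁, hne, hne', hprim₁⟩ := exists_cmType_flip h6 i Φ hprim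
  -- the auxiliary threefold `B₁ ⊨ (K; Φ₁)` (the tree's realisation record `cmAbelianVarietyRealised_holds`)
  obtain ⟨B₁, ι₁, θ₁, hB₁⟩ : ∃ (B₁ : AbelianVariety ℂ) (ι₁ : 𝓞 K →+* End B₁)
      (θ₁ : K →+* Module.End ℂ (complexBetti B₁.X 1)), IsCMTypeRealisation Φ₁ B₁ ι₁ θ₁ :=
    ⟨_, _, _, Domination.isCMTypeRealisation_cmCode K cmAbelianVarietyRealised_holds Φ₁⟩
  have h3 := hodgeConjectureFor_biproduct_comp_vec₃_of_not_isGalois_of_markman hW4 h6 h2 i hK hE hB hB₁ hprim hprim₁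
    hne hne' (fun j => Fin.castSucc (κ j))
  -- `![E, B, B₁] (castSucc x) = ![E, B] x`
  have hcast : ∀ x : Fin 2, (![E, B, B₁] : Fin 3 → AbelianVariety ℂ) (Fin.castSucc x) =
      (![E, B] : Fin 2 → AbelianVariety ℂ) x := Fin.forall_fin_two.2 ⟨rfl, rfl⟩
  let e : (⨁ fun j => (![E, B, B₁] : Fin 3 → AbelianVariety ℂ) (Fin.castSucc (κ j))) ≅
      ⨁ fun j => (![E, B] : Fin 2 → AbelianVariety ℂ) (κ j) :=
    biproduct.mapIso fun j => eqToIso (hcast (κ j))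
  have hdom : Domination.AVDominatedBy (⨁ fun j => (![E, B] : Fin 2 → AbelianVariety ℂ) (κ j))
      (⨁ fun j => (![E, B, B₁] : Fin 3 → AbelianVariety ℂ) (Fin.castSucc (κ j))) :=
    Domination.AVDominatedBy.of_iso e.symm (Domination.AVDominatedBy.refl _)
  exact Domination.hodgeConjectureFor_of_avDominatedBy h3 hdom

end NonGalois

/-! ## §5 The main theorem: any sextic CM field -/

section Main

variable {k K : Type} [Field k] [NumberField k] [IsCMField k] [Field K] [NumberField K] [IsCMField K] {N : ℕ}
  {E : AbelianVariety ℂ} {Ψ : CMType k} {ιE : 𝓞 k →+* End E} {θE : k →+* Module.End ℂ (complexBetti E.X 1)}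
  {B : AbelianVariety ℂ} {Φ : CMType K} {ιB : 𝓞 K →+* End B} {θB : K →+* Module.End ℂ (complexBetti B.X 1)}

/-- **The Hodge conjecture for every `⨁_j ![E, B] (κ j)` modulo Markman, intrinsic form**: `K` ANY sextic CM field,
`k` imaginary quadratic, `i : k → K`, `E ⊨ (k; Ψ)`, `B ⊨ (K; Φ)` with `Φ` NOT induced from `k` (e.g. `B` simple).
[cite: Markman2025SurveySecant, Thm. 1.2] [cite: Andre1992HodgeCM, Théorème] [cite: Shimura1998, §8.4] -/
theorem hodgeConjectureFor_biproduct_comp_vec_of_not_induced_of_markman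
    (hW4 : Markman2025_weilClasses_algebraic_abelianFourfold)
    (h6 : Module.finrank ℚ K = 6) (h2 : Module.finrank ℚ k = 2) (i : k →+* K)
    (hE : IsCMTypeRealisation Ψ E ιE θE) (hB : IsCMTypeRealisation Φ B ιB θB)
    (hprim : ∃ s ∈ Φ.1, ∃ s' ∈ Φ.1, s.comp i ≠ s'.comp i) (κ : Fin N → Fin 2) :
    HodgeConjectureFor (⨁ fun j => (![E, B] : Fin 2 → AbelianVariety ℂ) (κ j)).dim
      (⨁ fun j => (![E, B] : Fin 2 → AbelianVariety ℂ) (κ j)).X := by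
  by_cases hK : IsGalois ℚ K
  · exact hodgeConjectureFor_biproduct_comp_vec_of_isGalois_of_markman hW4 h6 i hE hB κ
  · exact hodgeConjectureFor_biproduct_comp_vec_of_not_isGalois_of_markman hW4 h6 h2 i hK hE hB hprim κ

/-- **MAIN THEOREM.  The Hodge conjecture for ALL PRODUCTS OF COPIES `E^c × B^a` of a simple CM abelian threefold and
a CM elliptic curve, modulo Markman's fourfold theorem.**  `K` ANY CM field of degree `6`, `k` an imaginary quadratic
field with `i : k →+* K`, `E ⊨ (k; Ψ)` a CM elliptic curve, `B ⊨ (K; Φ)` a SIMPLE abelian threefold: for every slot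
map `κ : Fin N → Fin 2`, every rational `(p,p)`-class on `⨁_j ![E, B] (κ j)` is algebraic, for every `p`, GIVEN ONLY
`Markman2025_weilClasses_algebraic_abelianFourfold`.  (Galois `K`: gen 11/12's face reduction; non-Galois `K`: gen 15's
pair theorem with an auxiliary conjugate threefold; simplicity ⟹ `Φ` not induced, Shimura §8.2 Prop. 26.)
[cite: Markman2025SurveySecant, Thm. 1.2 and §11.5 Step 2] [cite: Andre1992HodgeCM, Théorème]
[cite: Shimura1998, §8.2 Prop. 26, §8.4] [cite: Pohlmann1968, Thm 1] [cite: MoonenZarhin1999LowDim, Thm. 0.1] -/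
theorem hodgeConjectureFor_biproduct_comp_vec_of_markman (hW4 : Markman2025_weilClasses_algebraic_abelianFourfold)
    (h6 : Module.finrank ℚ K = 6) (h2 : Module.finrank ℚ k = 2) (i : k →+* K)
    (hE : IsCMTypeRealisation Ψ E ιE θE) (hB : IsCMTypeRealisation Φ B ιB θB) (hS : B.IsSimple)
    (κ : Fin N → Fin 2) :
    HodgeConjectureFor (⨁ fun j => (![E, B] : Fin 2 → AbelianVariety ℂ) (κ j)).dim
      (⨁ fun j => (![E, B] : Fin 2 → AbelianVariety ℂ) (κ j)).X :=
  hodgeConjectureFor_biproduct_comp_vec_of_not_induced_of_markman hW4 h6 h2 i hE hB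
    (DihedralSexticPair.exists_mem_comp_ne_of_isSimple h6 h2 i hB hS) κ

/-- **The Hodge conjecture for every abelian variety dominated by a product of copies of `E` and `B`**, modulo
Markman. [cite: Markman2025SurveySecant, Thm. 1.2] [cite: MumfordAV1970, §19] -/
theorem hodgeConjectureFor_of_avDominatedBy_comp_vec_of_markman
    (hW4 : Markman2025_weilClasses_algebraic_abelianFourfold)
    (h6 : Module.finrank ℚ K = 6) (h2 : Module.finrank ℚ k = 2) (i : k →+* K)
    (hE : IsCMTypeRealisation Ψ E ιE θE) (hB : IsCMTypeRealisation Φ B ιB θB) (hS : B.IsSimple)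
    (κ : Fin N → Fin 2) {A : AbelianVariety ℂ}
    (hA : Domination.AVDominatedBy A (⨁ fun j => (![E, B] : Fin 2 → AbelianVariety ℂ) (κ j))) :
    HodgeConjectureFor A.dim A.X :=
  Domination.hodgeConjectureFor_of_avDominatedBy (hodgeConjectureFor_biproduct_comp_vec_of_markman hW4 h6 h2 i hE hB hS κ)
    hA

/-- **… for every abelian variety ISOGENOUS TO A PRODUCT OF COPIES of `E` and `B`** (any finite index type).
[cite: Markman2025SurveySecant, Thm. 1.2] [cite: MumfordAV1970, §19] -/
theorem hodgeConjectureFor_of_isIsogenous_biproduct_comp_of_markman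
    (hW4 : Markman2025_weilClasses_algebraic_abelianFourfold)
    (h6 : Module.finrank ℚ K = 6) (h2 : Module.finrank ℚ k = 2) (i : k →+* K)
    (hE : IsCMTypeRealisation Ψ E ιE θE) (hB : IsCMTypeRealisation Φ B ιB θB) (hS : B.IsSimple)
    {J : Type} [Fintype J] (cls : J → Fin 2) {X : AbelianVariety ℂ}
    (hX : AbelianVariety.IsIsogenous X (⨁ fun j => (![E, B] : Fin 2 → AbelianVariety ℂ) (cls j))) :
    HodgeConjectureFor X.dim X.X := by
  classical
  let ε : Fin (Fintype.card J) ≃ J := (Fintype.equivFin J).symm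
  have e : (⨁ fun j => (![E, B] : Fin 2 → AbelianVariety ℂ) (cls j)) ≅
      ⨁ fun l => (![E, B] : Fin 2 → AbelianVariety ℂ) (cls (ε l)) :=
    (biproduct.reindex ε fun j => (![E, B] : Fin 2 → AbelianVariety ℂ) (cls j)).symm
  exact hodgeConjectureFor_of_avDominatedBy_comp_vec_of_markman hW4 h6 h2 i hE hB hS (fun l => cls (ε l))
    (Domination.AVDominatedBy.of_isIsogenous hX ((Domination.AVDominatedBy.refl _).of_iso_right e))

/-- **… and for ALL POWERS of such an abelian variety** (`X ∼ ⨁_{j : J} ![E, B] (cls j)` ⟹ `HC(X^{N+1})` for all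
`N`), modulo Markman. [cite: Markman2025SurveySecant, Thm. 1.2] [cite: Gordon1999HodgeAVSurvey, 7.6.1] -/
theorem hodgeConjectureFor_powSucc_of_isIsogenous_biproduct_comp_of_markman
    (hW4 : Markman2025_weilClasses_algebraic_abelianFourfold)
    (h6 : Module.finrank ℚ K = 6) (h2 : Module.finrank ℚ k = 2) (i : k →+* K)
    (hE : IsCMTypeRealisation Ψ E ιE θE) (hB : IsCMTypeRealisation Φ B ιB θB) (hS : B.IsSimple)
    {J : Type} [Fintype J] (cls : J → Fin 2) {X : AbelianVariety ℂ}
    (hX : AbelianVariety.IsIsogenous X (⨁ fun j => (![E, B] : Fin 2 → AbelianVariety ℂ) (cls j))) (M : ℕ) :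
    HodgeConjectureFor (X.powSucc M).dim (X.powSucc M).X := by
  obtain ⟨n, ρ, hdom⟩ := exists_avDominatedBy_powSucc_biproduct_slots_of_isIsogenous hX M
  exact hodgeConjectureFor_of_avDominatedBy_comp_vec_of_markman hW4 h6 h2 i hE hB hS ρ hdom

end Main

end Summit.HodgeConjecture.CorCM.SexticCMThreefold

end
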